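import Literature.NumberTheory.Automorphic.UnitaryRankTwoDepthValueLaw                      -- ★ p843418 A-p13 (inert twin): `exists_unitary_normalForm_elements`, §1 algebra, `apply_eq_apply_scalar_of_depth_le`
import Literature.NumberTheory.Automorphic.UnitaryRankTwoTorusLocalClassRamifiedSigned     -- ★-to-be B-p12 (g29) R-3 FILE 7: `localClass_signedNormalForm_ramified`
import HarnessLib

/-!
# The VALUE LAW at a fixed self-dual lattice for an elliptic regular element of `U(1,1)` at a TAMELY RAMIFIED place: the class function takes the value at the
# SIGNED normal-form element `c(1 + ϖ^i[[0, η^e],[0,0]])`, the bit `e` read off a residue square class (Labesse–Langlands 1979 §2 Lemma 2.1; Rogawski 1990 Lemma 4.9.3)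

Topic `NumberTheory/Automorphic`; namespace `Literature.NumberTheory.Automorphic`.  THEOREMS ONLY (no definition, no instance, no notation, no named fact, no `sorry`).
Cell `pub/hodgecm-mathlib` (D-0151), crux H413 = `stmt-HodgeConjecture-24833`, road «R1-ram» (MEMO-R1ram §4; architect A-p16 (g27) RULING A-19 (R5b-α)), FILE α1 of the
ramified one-place depth expansion (A-p13 (g32)); designer of record B-p12 (g29) (memo 06d3de01 (2)–(3)).  The RAMIFIED TWIN of ★ `UnitaryRankTwoDepthValueLaw` §2–§3:
* §1 `smul_nil_eq_smul_nil` (`ϖ^i • N(η^e) = (η^e) • N(ϖ^i)`) and **`exists_unitary_signedNormalForm_elements`** — for `σ c · c = 1`, `|c| = 1`, `σ ϖ = −ϖ`, `σ η = η` there are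
  `xm ∈ U(J₀)` and `x i e ∈ U(J₀)` (`i` ODD, `e ∈ ℕ`), all in `GL₂(𝒪)`, with `↑xm = c·1`, `↑(x i e) = c(1 + ϖ^i[[0,η^e],[0,0]])` and the displayed inverses (★ inert constructor
  at `(t, δ) := (η^e, ϖ^i)`: `σ(η^e) = η^e`, `σ(ϖ^i) = −ϖ^i`);
* §2 the eigenline of a conjugate: `exists_eq_smul_col_of_conj_diagonal_mulVec` (`k = g⁻¹γg`, `γP = P·diag(u)`, `u₀ ≠ u₁`, `kz = u₀z ⇒ z ∈ F·col₀(g⁻¹P)`) and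
  `pairing_col_eq_formCongr_apply` (`θ(col₀(g⁻¹P)) = (ᵗσ(P) J₀ P)₀₀` for `g ∈ U(J₀)`);
* §3 **`apply_eq_apply_signedNormalForm_of_depth_eq_ramified`** — for `φ : U(J₀) → E` invariant under `Ad K⁰` and right-`Km` (`Km` DATA with the level-`m` law) and
  `k ∈ U(J₀)` integral with `(k − a)(k − c) = 0`, exact depth `i < m ≤ N` at `c`, and an `a`-eigenline vector `v` with unit `θ = Σ σ(v_r)(J₀v)_r`:
  `Odd i ∧ Even (N+i) ∧ ∀ S = (−1)^{(N+i)∕2+1}·c·((a−c)ϖ^{−N})·θ, ∃ e ≤ 1, (e = 0 ↔ S̄ square) ∧ φ k = φ (x i e)` — over ★ B-p12 `localClass_signedNormalForm_ramified`.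
  The scalar law (depth `≥ m` ⇒ `φ k = φ xm`) is ★ `apply_eq_apply_scalar_of_depth_le`, σ-free, reused as is.
HONEST LABEL: HC_CM is proved only modulo the printed citations (hLiu418, h413) until rung 0 closes; nothing printed is asserted here.

## References
* [LabesseLanglands1979] J.-P. Labesse, R. P. Langlands, *L-indistinguishability for SL(2)*, Canad. J. Math. 31 (1979), §2 Lemma 2.1 pp. 8–9.
* [Rogawski1990] J. D. Rogawski, *Automorphic Representations of Unitary Groups in Three Variables* (1990), §4.9 Lemma 4.9.3 p. 56.
* [Jacobowitz1962] R. Jacobowitz, *Hermitian forms over local fields*, Amer. J. Math. 84 (1962), §4, §8.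
-/

set_option autoImplicit false

noncomputable section

open scoped ValuativeRel Matrix MatrixGroups
open Matrix ValuativeRel

namespace Literature.NumberTheory.Automorphic

variable {F : Type*} [Field F] [ValuativeRel F]

/-! ## §1 The signed normal-form elements of `U(J₀)` -/

section Elements

variable (σ : F →+* F)

omit [ValuativeRel F] in
/-- `t • [[0, δ],[0,0]] = δ • [[0, t],[0,0]]` — the corner is the product. [cite: Jacobowitz1962, §4] -/
theorem smul_nil_eq_smul_nil (t δ : F) : t • (!![0, δ; 0, 0] : Matrix (Fin 2) (Fin 2) F) = δ • !![0, t; 0, 0] := by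
  ext i j; fin_cases i <;> fin_cases j <;> simp [mul_comm]

/-- **THE SIGNED NORMAL-FORM ELEMENTS (tamely ramified).**  For `σ c · c = 1` with `|c| = 1`, `σ ϖ = −ϖ` with `ϖ ∈ 𝒪`, `σ η = η` with `η ∈ 𝒪`, and `J = [[0,1],[1,0]]`,
there are `xm ∈ U(J)` and `x : ℕ → ℕ → U(J)`, all in `GL₂(𝒪)`, with `↑xm = c • 1`, `↑xm⁻¹ = c⁻¹ • 1`, and FOR ODD `i`: `↑(x i e) = c • (1 + ϖ^i • [[0, η^e],[0,0]])`,
`↑(x i e)⁻¹ = c⁻¹ • (1 − ϖ^i • [[0, η^e],[0,0]])` (unitarity: `σ(ϖ^i η^e) = −ϖ^i η^e` for odd `i`). [cite: LabesseLanglands1979, §2 Lemma 2.1 pp. 8–9]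
[cite: Rogawski1990, §4.9 Lemma 4.9.3 p. 56] -/
theorem exists_unitary_signedNormalForm_elements (J : Matrix (Fin 2) (Fin 2) F) (hJ : J = !![0, 1; 1, 0]) {c ϖ η : F} (hc : σ c * c = 1) (hc1 : valuation F c = 1)
    (hσϖ : σ ϖ = -ϖ) (hϖO : ϖ ∈ 𝒪[F]) (hση : σ η = η) (hηO : η ∈ 𝒪[F]) :
    ∃ (xm : ↥(unitaryGroupOfForm σ J)) (x : ℕ → ℕ → ↥(unitaryGroupOfForm σ J)),
      (xm : GL (Fin 2) F) ∈ glInt 2 F ∧ (∀ i e, (x i e : GL (Fin 2) F) ∈ glInt 2 F) ∧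
      ((xm : GL (Fin 2) F) : Matrix (Fin 2) (Fin 2) F) = c • (1 : Matrix (Fin 2) (Fin 2) F) ∧
      (((xm : GL (Fin 2) F)⁻¹ : GL (Fin 2) F) : Matrix (Fin 2) (Fin 2) F) = c⁻¹ • (1 : Matrix (Fin 2) (Fin 2) F) ∧
      (∀ i e, Odd i → ((x i e : GL (Fin 2) F) : Matrix (Fin 2) (Fin 2) F) = c • ((1 : Matrix (Fin 2) (Fin 2) F) + ϖ ^ i • !![0, η ^ e; 0, 0])) ∧
      (∀ i e, Odd i → (((x i e : GL (Fin 2) F)⁻¹ : GL (Fin 2) F) : Matrix (Fin 2) (Fin 2) F) = c⁻¹ • ((1 : Matrix (Fin 2) (Fin 2) F) - ϖ ^ i • !![0, η ^ e; 0, 0])) := by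
  -- the scalar element, from the inert constructor at `(ϖ', δ) := (1, 0)`
  obtain ⟨xm, -, hxmI, -, hxm, hxm', -, -⟩ := exists_unitary_normalForm_elements σ J hJ hc hc1 (map_one σ) (one_mem _)
    (show σ (0 : F) = -0 by rw [map_zero, neg_zero]) (zero_mem _)
  -- the window elements: for odd `i` the inert constructor at `(ϖ', δ) := (η^e, ϖ^i)` (`σ(η^e) = η^e`, `σ(ϖ^i) = −ϖ^i`), index `1`
  have key : ∀ i e : ℕ, ∃ y : ↥(unitaryGroupOfForm σ J), (y : GL (Fin 2) F) ∈ glInt 2 F ∧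
      (Odd i → ((y : GL (Fin 2) F) : Matrix (Fin 2) (Fin 2) F) = c • ((1 : Matrix (Fin 2) (Fin 2) F) + ϖ ^ i • !![0, η ^ e; 0, 0]) ∧
        (((y : GL (Fin 2) F)⁻¹ : GL (Fin 2) F) : Matrix (Fin 2) (Fin 2) F) = c⁻¹ • ((1 : Matrix (Fin 2) (Fin 2) F) - ϖ ^ i • !![0, η ^ e; 0, 0])) := by
    intro i e
    by_cases hi : Odd i
    · have hσδ : σ (ϖ ^ i) = -(ϖ ^ i) := by rw [map_pow, hσϖ, Odd.neg_pow hi]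
      obtain ⟨-, x', -, hx'I, -, -, hx', hx''⟩ := exists_unitary_normalForm_elements σ J hJ hc hc1 (by rw [map_pow, hση] : σ (η ^ e) = η ^ e)
        (pow_mem hηO e) hσδ (pow_mem hϖO i)
      refine ⟨x' 1, hx'I 1, fun _ => ⟨?_, ?_⟩⟩
      · rw [hx' 1, pow_one, smul_nil_eq_smul_nil (ϖ ^ i) (η ^ e)]
      · rw [hx'' 1, pow_one, smul_nil_eq_smul_nil (ϖ ^ i) (η ^ e)]
    · exact ⟨xm, hxmI, fun h => absurd h hi⟩
  choose x hxI hx using key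
  exact ⟨xm, x, hxmI, hxI, hxm, hxm', fun i e hi => ((hx i e) hi).1, fun i e hi => ((hx i e) hi).2⟩

end Elements

/-! ## §2 The eigenline of a conjugate and its hermitian value -/

section Eigenline

variable (σ : F →+* F)

omit [ValuativeRel F] in
/-- **The `u₀`-eigenline of `k = g⁻¹γg` is `F · col₀(g⁻¹P)`** when `γP = P·diag(u)` with `u₀ ≠ u₁`. [cite: Rogawski1990, §4.9 p. 54] -/
theorem exists_eq_smul_col_of_conj_diagonal_mulVec (γ P g : GL (Fin 2) F) {u : Fin 2 → F}
    (hP : (γ : Matrix (Fin 2) (Fin 2) F) * P = P * diagonal u) (hu : u 0 ≠ u 1) (z : Fin 2 → F)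
    (hz : ((g⁻¹ * γ * g : GL (Fin 2) F) : Matrix (Fin 2) (Fin 2) F) *ᵥ z = u 0 • z) :
    ∃ ξ : F, z = ξ • fun r => (((g⁻¹ : GL (Fin 2) F) : Matrix (Fin 2) (Fin 2) F) * (P : Matrix (Fin 2) (Fin 2) F)) r 0 := by
  -- `P⁻¹ γ = diag(u) P⁻¹`
  have hγ : (γ : Matrix (Fin 2) (Fin 2) F) = (P : Matrix (Fin 2) (Fin 2) F) * diagonal u * ((P⁻¹ : GL (Fin 2) F) : Matrix (Fin 2) (Fin 2) F) := by
    rw [← hP, Matrix.mul_assoc, ← Units.val_mul, mul_inv_cancel, Units.val_one, Matrix.mul_one]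
  have hPinv : ((P⁻¹ : GL (Fin 2) F) : Matrix (Fin 2) (Fin 2) F) * (γ : Matrix (Fin 2) (Fin 2) F) = diagonal u * ((P⁻¹ : GL (Fin 2) F) : Matrix (Fin 2) (Fin 2) F) := by
    rw [hγ, ← Matrix.mul_assoc, ← Matrix.mul_assoc, ← Units.val_mul, inv_mul_cancel, Units.val_one, Matrix.one_mul]
  -- `γ (g z) = u₀ • (g z)`
  have hgk : (γ : Matrix (Fin 2) (Fin 2) F) *ᵥ ((g : Matrix (Fin 2) (Fin 2) F) *ᵥ z) = u 0 • ((g : Matrix (Fin 2) (Fin 2) F) *ᵥ z) := by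
    have e : (γ * g : GL (Fin 2) F) = g * (g⁻¹ * γ * g) := by group
    rw [Matrix.mulVec_mulVec, ← Units.val_mul, e, Units.val_mul, ← Matrix.mulVec_mulVec, hz, Matrix.mulVec_smul]
  -- `w := P⁻¹ (g z)` is a `u₀`-eigenvector of `diag(u)`, hence `w 1 = 0`
  set w : Fin 2 → F := ((P⁻¹ : GL (Fin 2) F) : Matrix (Fin 2) (Fin 2) F) *ᵥ ((g : Matrix (Fin 2) (Fin 2) F) *ᵥ z) with hw
  have hdw : diagonal u *ᵥ w = u 0 • w := by
    rw [hw, Matrix.mulVec_mulVec, ← hPinv, ← Matrix.mulVec_mulVec, hgk, Matrix.mulVec_smul]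
  have hw1 : w 1 = 0 := by
    have h := congrFun hdw 1
    rw [Matrix.mulVec_diagonal, Pi.smul_apply, smul_eq_mul] at h
    rcases mul_eq_mul_right_iff.1 h with h | h
    · exact absurd h.symm hu
    · exact h
  -- `z = (g⁻¹ P) w = w 0 • col₀(g⁻¹ P)`
  have hz' : z = (((g⁻¹ : GL (Fin 2) F) : Matrix (Fin 2) (Fin 2) F) * (P : Matrix (Fin 2) (Fin 2) F)) *ᵥ w := by
    rw [hw, Matrix.mulVec_mulVec, Matrix.mulVec_mulVec, ← Units.val_mul, ← Units.val_mul, ← Units.val_mul, show g⁻¹ * P * P⁻¹ * g = 1 by group,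
      Units.val_one, Matrix.one_mulVec]
  refine ⟨w 0, ?_⟩
  conv_lhs => rw [hz']
  ext r
  simp only [Matrix.mulVec, dotProduct, Fin.sum_univ_two, hw1, mul_zero, add_zero, Pi.smul_apply, smul_eq_mul, mul_comm (w 0)]

omit [ValuativeRel F] in
/-- **The hermitian value of `col₀(M)` is `(ᵗσ(M) J M)₀₀`.** [cite: Jacobowitz1962, §4] -/
theorem pairing_col_eq_conjTranspose_mul_apply (J M : Matrix (Fin 2) (Fin 2) F) :
    (fun r => σ (M r 0)) ⬝ᵥ (J *ᵥ fun r => M r 0) = ((M.map σ)ᵀ * J * M) 0 0 := by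
  simp only [dotProduct, Matrix.mulVec, Fin.sum_univ_two, Matrix.mul_apply, Matrix.transpose_apply, Matrix.map_apply]
  ring

omit [ValuativeRel F] in
/-- `ᵗσ(gP) J (gP) = ᵗσ(P) J P` for `ᵗσ(g) J g = J`. [cite: Jacobowitz1962, §4] -/
theorem conjTranspose_mul_form_mul_of_unitary (J : Matrix (Fin 2) (Fin 2) F) {g : Matrix (Fin 2) (Fin 2) F} (hg : (g.map σ)ᵀ * J * g = J)
    (P : Matrix (Fin 2) (Fin 2) F) : ((g * P).map σ)ᵀ * J * (g * P) = (P.map σ)ᵀ * J * P := by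
  rw [Matrix.map_mul, Matrix.transpose_mul]
  conv_rhs => rw [← hg]
  simp only [Matrix.mul_assoc]

omit [ValuativeRel F] in
/-- **For `g ∈ U(J)`, `θ(col₀(g⁻¹P)) = (ᵗσ(P) J P)₀₀`** — the hermitian value of the transported frame vector is that of the frame vector (`g⁻¹` is an isometry).
[cite: Jacobowitz1962, §4] [cite: Rogawski1990, §4.9 p. 54] -/
theorem pairing_col_eq_formCongr_apply (J : Matrix (Fin 2) (Fin 2) F) (g : ↥(unitaryGroupOfForm σ J)) (P : GL (Fin 2) F) :
    (fun r => σ (((((g⁻¹ : ↥(unitaryGroupOfForm σ J)) : GL (Fin 2) F) : Matrix (Fin 2) (Fin 2) F) * (P : Matrix (Fin 2) (Fin 2) F)) r 0)) ⬝ᵥ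
        (J *ᵥ fun r => ((((g⁻¹ : ↥(unitaryGroupOfForm σ J)) : GL (Fin 2) F) : Matrix (Fin 2) (Fin 2) F) * (P : Matrix (Fin 2) (Fin 2) F)) r 0) =
      (formCongr σ P J) 0 0 := by
  have hgU : (((((g⁻¹ : ↥(unitaryGroupOfForm σ J)) : GL (Fin 2) F) : Matrix (Fin 2) (Fin 2) F)).map σ)ᵀ * J *
      ((((g⁻¹ : ↥(unitaryGroupOfForm σ J)) : GL (Fin 2) F) : Matrix (Fin 2) (Fin 2) F)) = J := mem_unitaryGroupOfForm_iff.1 (g⁻¹).2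
  rw [pairing_col_eq_conjTranspose_mul_apply, conjTranspose_mul_form_mul_of_unitary σ J hgU]

end Eigenline

/-! ## §3 The signed value law at exact depth `i < m` -/

section ValueLaw

variable (σ : F →+* F) {ϖ : F} (hϖ : IsUniformizingElement ϖ) (hσϖ : σ ϖ = -ϖ)
  (σO : 𝒪[F] →+* 𝒪[F]) (hσO : ∀ x : 𝒪[F], ((σO x : 𝒪[F]) : F) = σ x) (hσσ : ∀ x, σO (σO x) = x)
  (J : Matrix (Fin 2) (Fin 2) F) (hJ : J = !![0, 1; 1, 0])

include hϖ hσϖ hσO hσσ hJ in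
/-- **THE SIGNED VALUE LAW AT DEPTH EXACTLY `i < m` (tamely ramified; over ★ B-p12 `localClass_signedNormalForm_ramified`).**  For `k ∈ U(J₀)` integral with
`(k − a)(k − c) = 0` (`a, c` norm-one units, `|a − c| = |ϖ^N|`), `i < m ≤ N`, `ϖ^{−i}(k − c·1)` integral but `ϖ^{−(i+1)}(k − c·1)` not, and a vector `v` spanning the
`a`-eigenline of `k` with `θ := Σ_r σ(v_r)(J₀v)_r` a unit: `i` is ODD, `N + i` is EVEN, and for `S = (−1)^{(N+i)∕2+1}·c·((a − c)ϖ^{−N})·θ` there is a bit `e ≤ 1`,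
`e = 0 ⟺ S̄` a square, with `φ k = φ (x i e)` for every `φ` invariant under `Ad K⁰` (`K⁰ = U(J₀) ∩ GL₂(𝒪)`) and right-`Km` (`Km` DATA with the level-`m` law), the
elements `x j e` having inverse matrices `c⁻¹(1 − ϖ^j[[0,η^e],[0,0]])` for odd `j` (`κ⁻¹ k κ = x_i^e · y`, `y ∈ Km`, `κ ∈ K⁰`).
[cite: LabesseLanglands1979, §2 Lemma 2.1 pp. 8–9] [cite: Rogawski1990, §4.9 Lemma 4.9.3 p. 56] [cite: Jacobowitz1962, §8] -/
theorem apply_eq_apply_signedNormalForm_of_depth_eq_ramified [IsAdicComplete (IsLocalRing.maximalIdeal 𝒪[F]) 𝒪[F]] [Finite (IsLocalRing.ResidueField 𝒪[F])]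
    (h2 : IsUnit (2 : 𝒪[F])) (hres : ∀ x : 𝒪[F], σO x - x ∈ IsLocalRing.maximalIdeal 𝒪[F])
    {η : 𝒪[F]} (hηu : IsUnit η) (hση : σO η = η) (hη : ¬ IsSquare (IsLocalRing.residue 𝒪[F] η))
    {a c : F} (ha : σ a * a = 1) (hc : σ c * c = 1) (ha1 : valuation F a = 1) (hc1 : valuation F c = 1)
    {N : ℕ} (hN : valuation F (a - c) = valuation F (ϖ ^ N)) {i m : ℕ} (him : i < m) (hmN : m ≤ N)
    (Km : Subgroup ↥(unitaryGroupOfForm σ J))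
    (hKm : ∀ y : ↥(unitaryGroupOfForm σ J),
      (∀ r s, ϖ ^ (-(m : ℤ)) * (((y : GL (Fin 2) F) : Matrix (Fin 2) (Fin 2) F) - 1) r s ∈ 𝒪[F]) → y ∈ Km)
    {E : Type*} (φ : ↥(unitaryGroupOfForm σ J) → E)
    (hφAd : ∀ κ : ↥(unitaryGroupOfForm σ J), (κ : GL (Fin 2) F) ∈ glInt 2 F → ∀ x, φ (κ * x * κ⁻¹) = φ x)
    (hφm : ∀ x, ∀ y ∈ Km, φ (x * y) = φ x)
    (x : ℕ → ℕ → ↥(unitaryGroupOfForm σ J))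
    (hx' : ∀ j e, Odd j → (((x j e : GL (Fin 2) F)⁻¹ : GL (Fin 2) F) : Matrix (Fin 2) (Fin 2) F) =
      c⁻¹ • ((1 : Matrix (Fin 2) (Fin 2) F) - ϖ ^ j • !![0, ((η : 𝒪[F]) : F) ^ e; 0, 0]))
    (k : ↥(unitaryGroupOfForm σ J)) (hkO : ∀ r s, ((k : GL (Fin 2) F) : Matrix (Fin 2) (Fin 2) F) r s ∈ 𝒪[F])
    (hac : (((k : GL (Fin 2) F) : Matrix (Fin 2) (Fin 2) F) - a • 1) * (((k : GL (Fin 2) F) : Matrix (Fin 2) (Fin 2) F) - c • 1) = 0)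
    (hki : ∀ r s, ϖ ^ (-(i : ℤ)) * (((k : GL (Fin 2) F) : Matrix (Fin 2) (Fin 2) F) - c • (1 : Matrix (Fin 2) (Fin 2) F)) r s ∈ 𝒪[F])
    (hki' : ¬ ∀ r s, ϖ ^ (-((i : ℤ) + 1)) * (((k : GL (Fin 2) F) : Matrix (Fin 2) (Fin 2) F) - c • (1 : Matrix (Fin 2) (Fin 2) F)) r s ∈ 𝒪[F])
    (v : Fin 2 → F) (hv : ∀ z : Fin 2 → F, ((k : GL (Fin 2) F) : Matrix (Fin 2) (Fin 2) F) *ᵥ z = a • z → ∃ ξ : F, z = ξ • v)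
    (hθ : valuation F ((fun r => σ (v r)) ⬝ᵥ (!![0, 1; 1, 0] *ᵥ v)) = 1) :
    Odd i ∧ Even (N + i) ∧ ∀ S : 𝒪[F], (S : F) = (-1) ^ ((N + i) / 2 + 1) * c * ((a - c) * (ϖ ^ N)⁻¹) * ((fun r => σ (v r)) ⬝ᵥ (!![0, 1; 1, 0] *ᵥ v)) →
      ∃ e : ℕ, e ≤ 1 ∧ (e = 0 ↔ IsSquare (IsLocalRing.residue 𝒪[F] S)) ∧ φ k = φ (x i e) := by
  subst hJ
  have hc0 : c ≠ 0 := fun h => by rw [h, map_zero] at hc1; exact zero_ne_one hc1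
  have hcO' : c⁻¹ ∈ 𝒪[F] := (Valuation.mem_integer_iff _ _).2 (by rw [map_inv₀, hc1, inv_one])
  have hσOmem : ∀ y ∈ 𝒪[F], σ y ∈ 𝒪[F] := fun y hy => by rw [← hσO ⟨y, hy⟩]; exact (σO ⟨y, hy⟩).2
  have hηeO : ∀ e : ℕ, ((η : 𝒪[F]) : F) ^ e ∈ 𝒪[F] := fun e => pow_mem η.2 e
  -- unitarity of `k` in the literal form
  have hkU : ((((k : GL (Fin 2) F) : Matrix (Fin 2) (Fin 2) F)).map σ)ᵀ * !![0, 1; 1, 0] * ((k : GL (Fin 2) F) : Matrix (Fin 2) (Fin 2) F) = !![0, 1; 1, 0] :=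
    mem_unitaryGroupOfForm_iff.1 k.2
  -- ★ the signed window class
  obtain ⟨hodd, hev, hall⟩ := localClass_signedNormalForm_ramified σ hϖ hσϖ σO hσO hσσ h2 hres hηu hση hη hkO hkU ha hc ha1 hc1 hac hN him hmN hki hki' v hv hθ
  refine ⟨hodd, hev, fun S hS => ?_⟩
  obtain ⟨κ, hκO, hκU, e, he, hiff, R, hRO, hid⟩ := hall S hS
  refine ⟨e, he, hiff, ?_⟩
  -- `κ` as an element of `K⁰ ⊆ U(J)`; its inverse is `J₀ κᴴ J₀`
  have hinv : !![(0 : F), 1; 1, 0] * (κ.map σ)ᵀ * !![0, 1; 1, 0] * κ = 1 := by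
    rw [Matrix.mul_assoc (!![(0 : F), 1; 1, 0] * (κ.map σ)ᵀ), Matrix.mul_assoc !![(0 : F), 1; 1, 0], ← Matrix.mul_assoc ((κ.map σ)ᵀ), hκU,
      swap_mul_swap_eq_one]
  have hinv' : κ * (!![(0 : F), 1; 1, 0] * (κ.map σ)ᵀ * !![0, 1; 1, 0]) = 1 := mul_eq_one_comm.1 hinv
  let κG : GL (Fin 2) F := ⟨κ, !![(0 : F), 1; 1, 0] * (κ.map σ)ᵀ * !![0, 1; 1, 0], hinv', hinv⟩
  have hκGU : κG ∈ unitaryGroupOfForm σ !![0, 1; 1, 0] := mem_unitaryGroupOfForm_iff.2 hκU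
  have hκinvO : ∀ r s, ((!![(0 : F), 1; 1, 0] * (κ.map σ)ᵀ * !![0, 1; 1, 0] : Matrix (Fin 2) (Fin 2) F)) r s ∈ 𝒪[F] := by
    intro r s
    rw [swap_mul_mul_swap_eq]
    fin_cases r <;> fin_cases s <;>
      simp only [Matrix.of_apply, Matrix.cons_val', Matrix.cons_val_zero, Matrix.cons_val_one, Matrix.cons_val_fin_one, Fin.zero_eta, Fin.mk_one,
        Matrix.transpose_apply, Matrix.map_apply] <;> exact hσOmem _ (hκO _ _)
  have hκGint : κG ∈ glInt 2 F := (mem_glInt_iff κG).2 ⟨hκO, hκinvO⟩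
  set κU : ↥(unitaryGroupOfForm σ !![0, 1; 1, 0]) := ⟨κG, hκGU⟩ with hκUdef
  -- `z := κ⁻¹ k κ` and `y := (x i e)⁻¹ z`
  have hz : (((κU⁻¹ * k * κU : ↥(unitaryGroupOfForm σ !![0, 1; 1, 0])) : GL (Fin 2) F) : Matrix (Fin 2) (Fin 2) F) =
      c • ((1 : Matrix (Fin 2) (Fin 2) F) + ϖ ^ i • !![0, ((η : 𝒪[F]) : F) ^ e; 0, 0]) + ϖ ^ m • R := by
    rw [Subgroup.coe_mul, Subgroup.coe_mul, Subgroup.coe_inv, Units.val_mul, Units.val_mul, Matrix.coe_units_inv, ← hid]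
    show κ⁻¹ * ((k : GL (Fin 2) F) : Matrix (Fin 2) (Fin 2) F) * κ = _
    rw [Matrix.inv_eq_left_inv hinv]
  have hy : (x i e)⁻¹ * (κU⁻¹ * k * κU) ∈ Km := by
    refine hKm _ fun r s => ?_
    have hxy : ((((x i e)⁻¹ * (κU⁻¹ * k * κU) : ↥(unitaryGroupOfForm σ !![0, 1; 1, 0])) : GL (Fin 2) F) : Matrix (Fin 2) (Fin 2) F) - 1 =
        ϖ ^ m • ((c⁻¹ • ((1 : Matrix (Fin 2) (Fin 2) F) - ϖ ^ i • !![0, ((η : 𝒪[F]) : F) ^ e; 0, 0])) * R) := by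
      rw [Subgroup.coe_mul, Subgroup.coe_inv, Units.val_mul, hz, hx' i e hodd, Matrix.mul_add, Matrix.smul_mul, Matrix.mul_smul, Matrix.mul_smul, smul_smul,
        inv_mul_cancel₀ hc0, one_smul, one_sub_smul_nil_mul_one_add_smul_nil, add_sub_cancel_left, Matrix.smul_mul]
    rw [hxy, Matrix.smul_apply, smul_eq_mul, ← mul_assoc, ← zpow_natCast, ← zpow_add₀ hϖ.ne_zero, neg_add_cancel, zpow_zero, one_mul]
    refine mul_apply_mem_integer (fun r s => ?_) hRO r s
    fin_cases r <;> fin_cases s <;>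
      simp only [Matrix.smul_apply, Matrix.sub_apply, Matrix.one_apply, Matrix.of_apply, Matrix.cons_val', Matrix.cons_val_zero, Matrix.cons_val_one,
        Matrix.cons_val_fin_one, Fin.zero_eta, Fin.mk_one, smul_eq_mul, Fin.isValue, if_true, one_ne_zero, zero_ne_one, if_false, mul_zero, sub_zero, zero_sub,
        mul_one, mul_neg] <;>
      first | exact hcO' | exact zero_mem _ | exact neg_mem (mul_mem hcO' (mul_mem (pow_mem hϖ.mem i) (hηeO e)))
  -- assemble: `k = κ · (x_i^e · y) · κ⁻¹`
  have hk : k = κU * (x i e * ((x i e)⁻¹ * (κU⁻¹ * k * κU))) * κU⁻¹ := by group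
  rw [hk, hφAd κU hκGint, hφm _ _ hy]

end ValueLaw

end Literature.NumberTheory.Automorphic

end
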